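import Summits.BirchSwinnertonDyer.BirchSwinnertonDyer.Theorems.KimAtThreeShallowEqDeepPositionDefs
import HarnessLib

/-!
# Route `KimAtThreeKolyvagin` (W2): the INEQUALITY form and the «up to a power of 3» form of the displayed position statement
# `KatoPeriodPositionAtThree` (route item 21401) — DEFINITIONS ONLY (cell `bsd-addord`, seat w2-c4 gen 14; three `def`s, no theorem,
# no named fact, no instance, no `sorry`)

HONEST FRAMING.  Nothing is asserted or proved here.  `KatoPositionLE W d κK` is a PREDICATE (VERBATIM `KatoPosition` of
`KimAtThreeShallowEqDeepPositionDefs` with its final `=` turned into `≤`); `KatoPeriodPositionLEAtThree` and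
`KatoPeriodPositionUpToPowAtThree` are closed `Prop`s that are EQUIVALENT REFORMULATIONS of the route item 21401
`KatoPeriodPositionThree := KatoPeriodPositionAtThree` — the equivalences are kernel theorems in the sibling proof file
`KimAtThreeShallowEqDeepPositionRescale` (w2-c4 gen 14): inside Kato's existential the displayed EQUALITY `v_3(u) = v(ι_3 e)` can always
be reached from the INEQUALITY by rescaling the datum by a power of `3` (`KimAtThreeShallowEqDeepPositionScaling.definedExpStarBody_natCast_mul`),
and all duality-normalising scalars of a line have the same valuation (`…Scaling.valuation_eq_of_forall_exists_eq_mul_iff_ball`).  They are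
tagged `@[conjecture]` for the same reason 21401 is: OPEN named statements of our theories, STRONGER than Kato's theorem, print status PRE
(module docstring of `KimAtThreeShallowEqDeepPositionDefs`).  They introduce NO new hypothesis into the route.  WHY A DEFS FILE: a
`theorem` whose statement spells the cross-application `Kato2004.DefinedExpStarBody W 3 P.f d …` at a `KatoPosition`-typed `d` inline
exceeds the kernel heartbeat budget (> 30 min on the farm), while the byte-identical text as a `def : Prop` elaborates in seconds (seat
finding 2026-08-27, four controlled farm runs) — so the reformulations are NAMED here and the theorems are stated over the names.
BSD is NOT proved by any of this; nothing is closed or booked.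
References: [Kato2004Asterisque] (8.1.3), 8.12, §9.4, 9.7, 6.6 (1), 13.3; [BlochKato1990] §3; [Kato1993LNM1553] II §1.2.4.
-/

noncomputable section

-- the cell's Theorems namespace `Summit.BirchSwinnertonDyer.BirchSwinnertonDyer.…` repeats the summit name by design (D-0017)
set_option linter.dupNamespace false

open scoped Classical NumberField TensorProduct Pointwise
open Field ValuativeRel Function IsDedekindDomain NumberField CongruenceSubgroup WeierstrassCurve
open Literature.NumberTheory.EllipticCurves
open Literature.NumberTheory.GaloisRepresentations
open Literature.NumberTheory.GaloisRepresentations.PeriodRingData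
open Literature.NumberTheory.GaloisRepresentations.IsNonarchimedeanLocalField
open Literature.NumberTheory.PAdicHodge Literature.NumberTheory.EllipticCurves.ModularForms
open Literature.NumberTheory.EllipticCurves.Kato2004 Literature.NumberTheory.EllipticCurves.Kato2004.EulerSystemValues
open Literature.NumberTheory.AdelicBaseChange Literature.NumberTheory.Automorphic
open Summit.BirchSwinnertonDyer.Rank1Residual.Additive.LocalLog
open Rat.HeightOneSpectrum
open Summit.BirchSwinnertonDyer.BirchSwinnertonDyer.Theorems.KimAtThreeShallowEqDeepPositionDefs

namespace Summit.BirchSwinnertonDyer.BirchSwinnertonDyer.Theorems.KimAtThreeShallowEqDeepPositionRescaleDefs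

-- The tree's `ℚ`-algebra structure on `ℚ_v = Place.Completion (inr v)` gets top priority LOCALLY, exactly as in
-- `KimAtThreeShallowEqDeepPositionDefs` and the Literature fact (so that the type of `d` below is syntactically the matrix's).
attribute [local instance 100001] NumberField.Place.instAlgebraCompletion

set_option backward.isDefEq.respectTransparency false in
/-- **The INEQUALITY form `KatoPositionLE W d κK` of the position clause** (w2-c4 gen 14): VERBATIM the text of
`KimAtThreeShallowEqDeepPositionDefs.KatoPosition W d κK` (w2-acc4 g6's POS_F in the currency of the Literature fact) with the final
EQUALITY `v_3(u) = v(ι_3 e)` replaced by the INEQUALITY `v_3(u) ≤ v(ι_3 e)`: «Kato's constant `κK = u ∈ ℚ` is AT MOST as 3-divisible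
as every duality-normalising scalar `e` of the line `d`» — the normalisation-exponent inequality `e(Ω⁺_f) ≥ 0` of crux 19077's
docstring.  A predicate; nothing asserted.  Inside Kato's `∃ (d ι κK Λ)` it is EQUIVALENT to the equality form (rescale the datum by
`3^{v(ι_3 e) − v_3(u)}`: `KimAtThreeShallowEqDeepPositionScaling.definedExpStarBody_natCast_mul` + rigidity of `e`; kernel proof in
`KimAtThreeShallowEqDeepPositionRescale`).
[cite: Kato2004Asterisque, §9.4 (p. 188), Thm. 9.7 (p. 189)] [cite: BlochKato1990, Def. 3.10 and Prop. 3.8] -/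
def KatoPositionLE (W : WeierstrassCurve ℚ) [W.IsElliptic] [W.IsGloballyMinimal]
    [ContinuousSMul ℤ_[3] (W.tateModule 3)] [Module.Free ℤ_[3] (W.tateModule 3)] [Module.Finite ℤ_[3] (W.tateModule 3)]
    (d :
      letI ρV := restrictedRationalTateRep W (NumberField.Place.Completion (Sum.inr ((Rat.HeightOneSpectrum.primesEquiv (R := 𝓞 ℚ)).symm ⟨3, Fact.out⟩) : NumberField.Place ℚ)) 3
      letI : ValuativeRel (NumberField.Place.Completion (Sum.inr ((Rat.HeightOneSpectrum.primesEquiv (R := 𝓞 ℚ)).symm ⟨3, Fact.out⟩) : NumberField.Place ℚ)) :=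
        inferInstanceAs (ValuativeRel ((((Rat.HeightOneSpectrum.primesEquiv (R := 𝓞 ℚ)).symm ⟨3, Fact.out⟩)).adicCompletion ℚ))
      letI : TopologicalSpace (NumberField.Place.Completion (Sum.inr ((Rat.HeightOneSpectrum.primesEquiv (R := 𝓞 ℚ)).symm ⟨3, Fact.out⟩) : NumberField.Place ℚ)) :=
        inferInstanceAs (TopologicalSpace ((((Rat.HeightOneSpectrum.primesEquiv (R := 𝓞 ℚ)).symm ⟨3, Fact.out⟩)).adicCompletion ℚ))
      haveI : IsNonarchimedeanLocalField (NumberField.Place.Completion (Sum.inr ((Rat.HeightOneSpectrum.primesEquiv (R := 𝓞 ℚ)).symm ⟨3, Fact.out⟩) : NumberField.Place ℚ)) :=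
        inferInstanceAs (IsNonarchimedeanLocalField ((((Rat.HeightOneSpectrum.primesEquiv (R := 𝓞 ℚ)).symm ⟨3, Fact.out⟩)).adicCompletion ℚ))
      haveI : CharZero (NumberField.Place.Completion (Sum.inr ((Rat.HeightOneSpectrum.primesEquiv (R := 𝓞 ℚ)).symm ⟨3, Fact.out⟩) : NumberField.Place ℚ)) := LocalField.charZero_adicCompletion ((Rat.HeightOneSpectrum.primesEquiv (R := 𝓞 ℚ)).symm ⟨3, Fact.out⟩)
      letI : Algebra ℚ_[3] (NumberField.Place.Completion (Sum.inr ((Rat.HeightOneSpectrum.primesEquiv (R := 𝓞 ℚ)).symm ⟨3, Fact.out⟩) : NumberField.Place ℚ)) :=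
        LocalField.adicCompletionPadicAlgebra ((Rat.HeightOneSpectrum.primesEquiv (R := 𝓞 ℚ)).symm ⟨3, Fact.out⟩) 3 ((natCast_mem_asIdeal_iff_eq_primesEquiv_symm _ Nat.prime_three).mpr rfl)
      haveI : Fact (¬ IsUnit ((3 : ℕ) : integerC (NumberField.Place.Completion (Sum.inr ((Rat.HeightOneSpectrum.primesEquiv (R := 𝓞 ℚ)).symm ⟨3, Fact.out⟩) : NumberField.Place ℚ)))) :=
        ⟨not_isUnit_natCast_integerC (show valuation (NumberField.Place.Completion (Sum.inr ((Rat.HeightOneSpectrum.primesEquiv (R := 𝓞 ℚ)).symm ⟨3, Fact.out⟩) : NumberField.Place ℚ)) ((3 : ℕ) : (NumberField.Place.Completion (Sum.inr ((Rat.HeightOneSpectrum.primesEquiv (R := 𝓞 ℚ)).symm ⟨3, Fact.out⟩) : NumberField.Place ℚ))) < 1 from LocalField.valuation_adicCompletion_natCast_lt_one ((Rat.HeightOneSpectrum.primesEquiv (R := 𝓞 ℚ)).symm ⟨3, Fact.out⟩) 3 ((natCast_mem_asIdeal_iff_eq_primesEquiv_symm _ Nat.prime_three).mpr rfl))⟩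
      haveI := isAdicComplete_integerC_natCast (show valuation (NumberField.Place.Completion (Sum.inr ((Rat.HeightOneSpectrum.primesEquiv (R := 𝓞 ℚ)).symm ⟨3, Fact.out⟩) : NumberField.Place ℚ)) ((3 : ℕ) : (NumberField.Place.Completion (Sum.inr ((Rat.HeightOneSpectrum.primesEquiv (R := 𝓞 ℚ)).symm ⟨3, Fact.out⟩) : NumberField.Place ℚ))) < 1 from LocalField.valuation_adicCompletion_natCast_lt_one ((Rat.HeightOneSpectrum.primesEquiv (R := 𝓞 ℚ)).symm ⟨3, Fact.out⟩) 3 ((natCast_mem_asIdeal_iff_eq_primesEquiv_symm _ Nat.prime_three).mpr rfl))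
      (bdRPeriodRingData (show valuation (NumberField.Place.Completion (Sum.inr ((Rat.HeightOneSpectrum.primesEquiv (R := 𝓞 ℚ)).symm ⟨3, Fact.out⟩) : NumberField.Place ℚ)) ((3 : ℕ) : (NumberField.Place.Completion (Sum.inr ((Rat.HeightOneSpectrum.primesEquiv (R := 𝓞 ℚ)).symm ⟨3, Fact.out⟩) : NumberField.Place ℚ))) < 1 from LocalField.valuation_adicCompletion_natCast_lt_one ((Rat.HeightOneSpectrum.primesEquiv (R := 𝓞 ℚ)).symm ⟨3, Fact.out⟩) 3 ((natCast_mem_asIdeal_iff_eq_primesEquiv_symm _ Nat.prime_three).mpr rfl))).FilZeroLine ρV)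
    (κK : ℝ) : Prop :=
  letI ρT := restrictedTateRep W (NumberField.Place.Completion (Sum.inr ((Rat.HeightOneSpectrum.primesEquiv (R := 𝓞 ℚ)).symm ⟨3, Fact.out⟩) : NumberField.Place ℚ)) 3
  letI : ValuativeRel (NumberField.Place.Completion (Sum.inr ((Rat.HeightOneSpectrum.primesEquiv (R := 𝓞 ℚ)).symm ⟨3, Fact.out⟩) : NumberField.Place ℚ)) :=
    inferInstanceAs (ValuativeRel ((((Rat.HeightOneSpectrum.primesEquiv (R := 𝓞 ℚ)).symm ⟨3, Fact.out⟩)).adicCompletion ℚ))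
  letI : TopologicalSpace (NumberField.Place.Completion (Sum.inr ((Rat.HeightOneSpectrum.primesEquiv (R := 𝓞 ℚ)).symm ⟨3, Fact.out⟩) : NumberField.Place ℚ)) :=
    inferInstanceAs (TopologicalSpace ((((Rat.HeightOneSpectrum.primesEquiv (R := 𝓞 ℚ)).symm ⟨3, Fact.out⟩)).adicCompletion ℚ))
  haveI : IsNonarchimedeanLocalField (NumberField.Place.Completion (Sum.inr ((Rat.HeightOneSpectrum.primesEquiv (R := 𝓞 ℚ)).symm ⟨3, Fact.out⟩) : NumberField.Place ℚ)) :=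
    inferInstanceAs (IsNonarchimedeanLocalField ((((Rat.HeightOneSpectrum.primesEquiv (R := 𝓞 ℚ)).symm ⟨3, Fact.out⟩)).adicCompletion ℚ))
  haveI : CharZero (NumberField.Place.Completion (Sum.inr ((Rat.HeightOneSpectrum.primesEquiv (R := 𝓞 ℚ)).symm ⟨3, Fact.out⟩) : NumberField.Place ℚ)) := LocalField.charZero_adicCompletion ((Rat.HeightOneSpectrum.primesEquiv (R := 𝓞 ℚ)).symm ⟨3, Fact.out⟩)
  letI : Algebra ℚ_[3] (NumberField.Place.Completion (Sum.inr ((Rat.HeightOneSpectrum.primesEquiv (R := 𝓞 ℚ)).symm ⟨3, Fact.out⟩) : NumberField.Place ℚ)) :=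
    LocalField.adicCompletionPadicAlgebra ((Rat.HeightOneSpectrum.primesEquiv (R := 𝓞 ℚ)).symm ⟨3, Fact.out⟩) 3 ((natCast_mem_asIdeal_iff_eq_primesEquiv_symm _ Nat.prime_three).mpr rfl)
  haveI : Fact (¬ IsUnit ((3 : ℕ) : integerC (NumberField.Place.Completion (Sum.inr ((Rat.HeightOneSpectrum.primesEquiv (R := 𝓞 ℚ)).symm ⟨3, Fact.out⟩) : NumberField.Place ℚ)))) :=
    ⟨not_isUnit_natCast_integerC (show valuation (NumberField.Place.Completion (Sum.inr ((Rat.HeightOneSpectrum.primesEquiv (R := 𝓞 ℚ)).symm ⟨3, Fact.out⟩) : NumberField.Place ℚ)) ((3 : ℕ) : (NumberField.Place.Completion (Sum.inr ((Rat.HeightOneSpectrum.primesEquiv (R := 𝓞 ℚ)).symm ⟨3, Fact.out⟩) : NumberField.Place ℚ))) < 1 from LocalField.valuation_adicCompletion_natCast_lt_one ((Rat.HeightOneSpectrum.primesEquiv (R := 𝓞 ℚ)).symm ⟨3, Fact.out⟩) 3 ((natCast_mem_asIdeal_iff_eq_primesEquiv_symm _ Nat.prime_three).mpr rfl))⟩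
  haveI := isAdicComplete_integerC_natCast (show valuation (NumberField.Place.Completion (Sum.inr ((Rat.HeightOneSpectrum.primesEquiv (R := 𝓞 ℚ)).symm ⟨3, Fact.out⟩) : NumberField.Place ℚ)) ((3 : ℕ) : (NumberField.Place.Completion (Sum.inr ((Rat.HeightOneSpectrum.primesEquiv (R := 𝓞 ℚ)).symm ⟨3, Fact.out⟩) : NumberField.Place ℚ))) < 1 from LocalField.valuation_adicCompletion_natCast_lt_one ((Rat.HeightOneSpectrum.primesEquiv (R := 𝓞 ℚ)).symm ⟨3, Fact.out⟩) 3 ((natCast_mem_asIdeal_iff_eq_primesEquiv_symm _ Nat.prime_three).mpr rfl))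
  ∃ u : ℚ, (u : ℝ) = κK ∧
    ∀ (e : (((Rat.HeightOneSpectrum.primesEquiv (R := 𝓞 ℚ)).symm ⟨3, Fact.out⟩)).adicCompletion ℚ), e ≠ 0 →
      (∀ a : ℚ_[3],
        (∃ η₀ : contOneCocycles ρT.toTopRep,
            (((Padic.adicCompletionEquiv (𝓞 ℚ) ⟨3, Fact.out⟩).symm : ((((Rat.HeightOneSpectrum.primesEquiv (R := 𝓞 ℚ)).symm ⟨3, Fact.out⟩)).adicCompletion ℚ) →+* ℚ_[3])) (expStarCoord W (show valuation (NumberField.Place.Completion (Sum.inr ((Rat.HeightOneSpectrum.primesEquiv (R := 𝓞 ℚ)).symm ⟨3, Fact.out⟩) : NumberField.Place ℚ)) ((3 : ℕ) : (NumberField.Place.Completion (Sum.inr ((Rat.HeightOneSpectrum.primesEquiv (R := 𝓞 ℚ)).symm ⟨3, Fact.out⟩) : NumberField.Place ℚ))) < 1 from LocalField.valuation_adicCompletion_natCast_lt_one ((Rat.HeightOneSpectrum.primesEquiv (R := 𝓞 ℚ)).symm ⟨3, Fact.out⟩) 3 ((natCast_mem_asIdeal_iff_eq_primesEquiv_symm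 _ Nat.prime_three).mpr rfl)) d η₀ : (NumberField.Place.Completion (Sum.inr ((Rat.HeightOneSpectrum.primesEquiv (R := 𝓞 ℚ)).symm ⟨3, Fact.out⟩) : NumberField.Place ℚ))) = (((Padic.adicCompletionEquiv (𝓞 ℚ) ⟨3, Fact.out⟩).symm : ((((Rat.HeightOneSpectrum.primesEquiv (R := 𝓞 ℚ)).symm ⟨3, Fact.out⟩)).adicCompletion ℚ) →+* ℚ_[3])) e * a) ↔
          ∀ Q : (W.baseChange ℚ_[3]).toAffine.Point, ‖a * padicLog (W.baseChange ℚ_[3]) Q‖ ≤ 1) →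
      padicValRat 3 u ≤ ((((Padic.adicCompletionEquiv (𝓞 ℚ) ⟨3, Fact.out⟩).symm : ((((Rat.HeightOneSpectrum.primesEquiv (R := 𝓞 ℚ)).symm ⟨3, Fact.out⟩)).adicCompletion ℚ) →+* ℚ_[3])) e).valuation

set_option backward.isDefEq.respectTransparency false in
/-- **`KatoPeriodPositionLEAtThree`** — the INEQUALITY form of the W2 route's displayed statement `KatoPeriodPositionAtThree`
(route item 21401 `KatoPeriodPositionThree`): the same text with `KatoPosition` replaced by `KatoPositionLE`.  It is an EQUIVALENT
REFORMULATION of item 21401 (kernel theorem `KimAtThreeShallowEqDeepPositionRescale.katoPeriodPositionAtThree_iff_le`), NOT a new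
hypothesis and NOT weaker: tagged `@[conjecture]` only because, like 21401, it is an OPEN named statement of our theories (STRONGER than
Kato's theorem; the route's own hypothesis; print status PRE).  Written as a `def` — not inline in a theorem — because theorem
STATEMENTS spelling Kato's matrix at a `KatoPosition`-typed `d` exceed the kernel budget while `def` bodies do not (seat finding).
Nothing asserted; no `_holds` is claimed; BSD is not proved by any of this. -/
@[conjecture] def KatoPeriodPositionLEAtThree : Prop :=
  ∀ (W : WeierstrassCurve ℚ) [W.IsElliptic] [W.IsGloballyMinimal]
    [ContinuousSMul ℤ_[3] (W.tateModule 3)] [Module.Free ℤ_[3] (W.tateModule 3)]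
    [Module.Finite ℤ_[3] (W.tateModule 3)],
    (∀ m : ℕ, W.HasSurjectiveModNGaloisRep (3 ^ m : ℕ)) →
    ∀ {N : ℕ} [NeZero N] (P : ModularParametrizationData W N), N = W.conductorNorm ℤ →
      (∀ z ∈ P.L.lattice, ∃ w ∈ periodLattice P.f, z = P.c * w) →
      ∃ d ι κK Λ, κK ≠ 0 ∧ KatoPositionLE W d κK ∧ Kato2004.DefinedExpStarBody W 3 P.f d ι κK Λ

set_option backward.isDefEq.respectTransparency false in
/-- **`KatoPeriodPositionUpToPowAtThree`** — item 21401's text with the position clause weakened to «`KatoPosition W d (3^m · κK)`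
for SOME `m : ℕ`» (position UP TO A POWER OF 3).  EQUIVALENT to item 21401 (rescale the datum by `3^m`;
`KimAtThreeShallowEqDeepPositionRescale.katoPeriodPositionAtThree_iff_upToPow`) and to `KatoPeriodPositionLEAtThree`; the intermediate
form of the equivalence proof.  Same honesty clauses as above: an equivalent reformulation, `@[conjecture]` because open; nothing
asserted. -/
@[conjecture] def KatoPeriodPositionUpToPowAtThree : Prop :=
  ∀ (W : WeierstrassCurve ℚ) [W.IsElliptic] [W.IsGloballyMinimal]
    [ContinuousSMul ℤ_[3] (W.tateModule 3)] [Module.Free ℤ_[3] (W.tateModule 3)]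
    [Module.Finite ℤ_[3] (W.tateModule 3)],
    (∀ m : ℕ, W.HasSurjectiveModNGaloisRep (3 ^ m : ℕ)) →
    ∀ {N : ℕ} [NeZero N] (P : ModularParametrizationData W N), N = W.conductorNorm ℤ →
      (∀ z ∈ P.L.lattice, ∃ w ∈ periodLattice P.f, z = P.c * w) →
      ∃ d ι κK Λ, κK ≠ 0 ∧ (∃ m : ℕ, KatoPosition W d (((3 ^ m : ℕ) : ℝ) * κK)) ∧ Kato2004.DefinedExpStarBody W 3 P.f d ι κK Λ

end Summit.BirchSwinnertonDyer.BirchSwinnertonDyer.Theorems.KimAtThreeShallowEqDeepPositionRescaleDefs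

end
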